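import Summits.QuantumFields.YangMills.Theorems.LangevinControlUVOSLegsAtWeakCouplingCDefs
import Summits.QuantumFields.YangMills.Theorems.LangevinControlUVOSLegsFromFemtoAndGapStubAssemblyPermutations
import HarnessLib

/-!
# Crux `OSLegsAtWeakCouplingC` (stmt-QuantumFields-16207), line `Sketch`: the E1 leg is NECESSARY (lattice form)

Support file (continuation lead c5), companion of `…SketchNecessityNT.lean`.  The line closes the crux modulo E0′, NT
and an E1 input; one admissible typing of the E1 input is LATTICE-side (the rotation-Ward defect of the renormalised
lattice `n`-point distributions `→ 0` on the germ along schemes in units `a`).  This file records that a lattice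
rotation-defect statement of exactly this kind is part of the CONTENT of the crux's conclusion: `ConclC G r a` asserts,
along the witnessing scheme (units `a`, `β_k → ∞`, uniform lattice gap, tori of diverging physical size), that for
EVERY proper linear isometry `R` of `ℝ⁴` and every real tensor test function on `⁰𝒮` the renormalised lattice
`n`-point function of the rotated test functions minus that of the unrotated ones tends to `0` — because both converge
(`IsYangMillsFor`) and the limits agree by E1 of the OS data (`OSData.invariant`).

* `conclC_imp_latticeRotationDefect` — the statement above;
* `osLegsAtWeakCouplingC_imp_latticeRotationDefect` — read off the crux BY NAME at every `(G, r, a)` carrying its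
  hypotheses.

Refs: OsterwalderSchrader1973 §3 (E1); JaffeWitten2000 §6; the catalogued barrier
`Literature.Barriers.QuantumFields.RegularisationDichotomy` (rotation restoration of hypercubic limits) is what this
necessary condition runs into.
-/

set_option autoImplicit false

noncomputable section

open scoped SchwartzMap
open MeasureTheory Filter Topology
open Literature.MathematicalPhysics.QuantumFieldTheory Literature.MathematicalPhysics.QuantumLattice
open Literature.MathematicalPhysics.AQFT
open Summit.QuantumFields.YangMills.Theses.LangevinControlUV (OSLegsAtWeakCouplingC)
open Summit.QuantumFields.YangMills.Cruxes.OSLegsFromFemtoAndGap.DlrCollarTransfer (TwoPoint Skewness GapInUnits)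

namespace Summit.QuantumFields.YangMills.Cruxes.OSLegsAtWeakCouplingC.Sketch

variable {G : Type} [Group G] [TopologicalSpace G] [IsTopologicalGroup G] [CompactSpace G]
  [MeasurableSpace G] [BorelSpace G]

/-- **E1 is necessary (lattice form): the crux's conclusion asserts that the lattice rotation defect vanishes along
the witnessing scheme.**  If `ConclC G r a` holds then along some scheme in units `a` with `β_k → +∞`, a uniform
lattice gap and tori of physical size eventually exceeding every bound, for every `n ≥ 1`, every proper linear
isometry `R` of `ℝ⁴`, and every real tensor test function `F = f₁ ⊗ ⋯ ⊗ fₙ ∈ ⁰𝒮`, the difference of the renormalised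
lattice `n`-point functions of the curvature on the rotated factors `fᵢ ∘ R⁻¹` and on the `fᵢ` tends to `0`. -/
theorem conclC_imp_latticeRotationDefect (r : LatticeRep G) (a : ℝ → ℝ) (h : ConclC G r a) :
    ∃ sch : SpeciesScheme (YMSpecies G), (∀ k, sch.a k = a (sch.β k)) ∧ sch.HasWeakCouplingLimit ∧
      (∃ Δ : ℝ, 0 < Δ ∧ HasLatticeMassGap r sch Δ) ∧
      (∀ ℓ₀ : ℝ, ∀ᶠ k in atTop, ℓ₀ < sch.a k * sch.L k) ∧
      ∀ (n : ℕ), n ≠ 0 → ∀ (R : (EuclideanSpace ℝ (Fin 4)) ≃ₗᵢ[ℝ] (EuclideanSpace ℝ (Fin 4))), LinearMap.det (R.toLinearEquiv : (EuclideanSpace ℝ (Fin 4)) →ₗ[ℝ] (EuclideanSpace ℝ (Fin 4))) = 1 →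
        ∀ (f : Fin n → 𝓢((EuclideanSpace ℝ (Fin 4)), ℝ)) (F : 𝓢((Fin n → (EuclideanSpace ℝ (Fin 4))), ℂ)),
          IsTensorOf F (fun i => ofRealTest (f i)) → IsOffDiagonal F →
            Tendsto (fun k : ℕ =>
              latticeSchwinger r.ρ sch (fun s => s.F) k n (fun _ => r.curvature) (fun i => linActTest R (f i)) -
                latticeSchwinger r.ρ sch (fun s => s.F) k n (fun _ => r.curvature) f) atTop (𝓝 0) := by
  obtain ⟨sch, T, hunits, hw, hYM, -, -, Δ, hΔ, hlat⟩ := h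
  refine ⟨sch, hunits, hw, ⟨Δ, hΔ, hlat⟩, fun ℓ₀ => ?_, fun n hn R hR f F hF hoff => ?_⟩
  · exact (sch.tendsto_L.eventually (eventually_gt_atTop ℓ₀)).mono fun k hk => hk
  · -- both lattice sequences converge, and the limits agree by E1 of the OS data
    have h1 := hYM n hn (fun _ => r.curvature) f F hF hoff
    have h2 := hYM n hn (fun _ => r.curvature) (fun i => linActTest R (f i)) (linActMulti R F)
      (hF.linActMulti R) (hoff.linActMulti R)
    rw [T.invariant.2 n (fun _ => r.curvature) R hR F hoff] at h2
    have hsub := h2.sub h1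
    rw [sub_self] at hsub
    have hre := (Complex.continuous_re.tendsto (0 : ℂ)).comp hsub
    simpa [Function.comp_def, Complex.sub_re, Complex.ofReal_re] using hre

/-- **The crux BY NAME entails the vanishing of the lattice rotation defect** along a scheme in units `a`, at every
`(G, r, a)` carrying its hypotheses (`cruxC_iff` + `conclC_imp_latticeRotationDefect`). -/
theorem osLegsAtWeakCouplingC_imp_latticeRotationDefect (h : OSLegsAtWeakCouplingC) :
    ∀ (G : Type) [Group G] [TopologicalSpace G] [IsTopologicalGroup G] [CompactSpace G],
      IsCompactSimpleLieGroup G → letI : MeasurableSpace G := borel G; haveI : BorelSpace G := ⟨rfl⟩;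
      ∀ (r : LatticeRep G) (a : ℝ → ℝ), Continuous a → TwoPoint G r a → Skewness G r a → GapInUnits G r a →
        ∃ sch : SpeciesScheme (YMSpecies G), (∀ k, sch.a k = a (sch.β k)) ∧ sch.HasWeakCouplingLimit ∧
          (∃ Δ : ℝ, 0 < Δ ∧ HasLatticeMassGap r sch Δ) ∧
          (∀ ℓ₀ : ℝ, ∀ᶠ k in atTop, ℓ₀ < sch.a k * sch.L k) ∧
          ∀ (n : ℕ), n ≠ 0 → ∀ (R : (EuclideanSpace ℝ (Fin 4)) ≃ₗᵢ[ℝ] (EuclideanSpace ℝ (Fin 4))), LinearMap.det (R.toLinearEquiv : (EuclideanSpace ℝ (Fin 4)) →ₗ[ℝ] (EuclideanSpace ℝ (Fin 4))) = 1 →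
            ∀ (f : Fin n → 𝓢((EuclideanSpace ℝ (Fin 4)), ℝ)) (F : 𝓢((Fin n → (EuclideanSpace ℝ (Fin 4))), ℂ)),
              IsTensorOf F (fun i => ofRealTest (f i)) → IsOffDiagonal F →
                Tendsto (fun k : ℕ =>
                  latticeSchwinger r.ρ sch (fun s => s.F) k n (fun _ => r.curvature) (fun i => linActTest R (f i)) -
                    latticeSchwinger r.ρ sch (fun s => s.F) k n (fun _ => r.curvature) f) atTop (𝓝 0) := by
  rw [cruxC_iff] at h
  intro G _ _ _ _ hG
  letI : MeasurableSpace G := borel G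
  haveI : BorelSpace G := ⟨rfl⟩
  intro r a ha h1 h2 h3
  exact conclC_imp_latticeRotationDefect r a (h G hG r a ha h1 h2 h3)

end Summit.QuantumFields.YangMills.Cruxes.OSLegsAtWeakCouplingC.Sketch

end
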